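import Summits.Ventures.PercRepro.MSTightCompletionRows
import Summits.Ventures.PercRepro.MSLemmaXWithin
import Summits.Ventures.PercRepro.MSTightConjTCorollaries

/-!
# (ROW-a): all partnerless `r`-free members of a shape-A configuration lie in ONE row

Dossier proofs/MINE1-theoremS.md, Addendum 57 suppl. 4 (THEOREM (ROW-a)); HANDOFF §mine-1
gen 32 → 33, step (K3). Setting: `F` twin-free, genuine (`|D(F)| = |F| + 1`, `∅, univ ∉ F`, empty
core, full support), `r` with a tight trace `P = proj r F` and SHAPE A (`completion0 r F` tight),
and at least one `r`-member without an `r`-free partner (`¬ partr r F ⊆ part0 r F`, i.e.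
`U ∖ U₀ ≠ ∅`, `cU_sdiff_cU0_nonempty`). In the coordinates of `MSTightCompletionCoords.lean`:

* a NON-FULL row (`K^x ≠ U₀`) has fibre excess at least one, `|K^x| + 1 ≤ |Z^x|`
  (`card_fibre_partner_add_one_le`: Lemma X within `M` and the row inclusion);
* the total excess is one: `Σ_{x ∈ L} (|Z^x| − |K^x|) = |Y| − |K| = 1`
  (`sum_fibre_excess_eq_one`, from `card_diffsY_of_genuine`);
* hence the row `x_s = s ∖ M` of a partnerless `r`-free member `s` has excess EXACTLY one
  (`card_fibre_diffsY_eq_add_one`), every other row has excess zero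
  (`card_fibre_diffsY_eq_of_ne`), and **(ROW-a)**: two partnerless `r`-free members have the same
  row, `s ∖ M = s' ∖ M` (`sdiff_cM_eq_of_notMem_partner`).
-/

namespace PercRepro.MSTight

open Finset
open scoped FinsetFamily

variable {α : Type*} [DecidableEq α] [Fintype α] {F : Finset (Finset α)} {r : α}

section RowA

/-- `U ∖ U₀` is nonempty when some `r`-member has no `r`-free partner. -/
theorem cU_sdiff_cU0_nonempty (htw : ∀ a b, Twin F a b → a = b) (hcore : ∀ a, ∃ t ∈ F, a ∉ t)
    (hC : Tight (completion0 r F)) (h : ¬ partr r F ⊆ part0 r F) :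
    (cU r F \ cU0 r F).Nonempty := by
  obtain ⟨t, ht, ht0⟩ := not_subset.1 h
  have htP : t ∈ proj r F := mem_proj_of_mem_partr ht
  refine ⟨t ∩ cM r F, mem_sdiff.2 ⟨inter_cM_mem_cU_of_mem_proj htw hcore hC htP, fun h0 => ht0 ?_⟩⟩
  have := union_mem_part0 htw hcore hC (sdiff_cM_mem_cL_of_mem_proj htw hcore hC htP) h0
  rwa [sdiff_union_inter] at this

/-- **A non-full row has fibre excess at least one**: `|K^x| + 1 ≤ |Z^x|` when `K^x ≠ U₀`. -/
theorem card_fibre_partner_add_one_le (htw : ∀ a b, Twin F a b → a = b)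
    (hcore : ∀ a, ∃ t ∈ F, a ∉ t) (hC : Tight (completion0 r F))
    (hU₁ : (cU r F \ cU0 r F).Nonempty) {x : Finset α} (hx : x ∈ cL r F)
    (hne : fibre (cM r F) (partner r F) x ≠ cU0 r F) :
    (fibre (cM r F) (partner r F) x).card + 1 ≤ (fibre (cM r F) (diffsY r F) x).card :=
  (lemmaX_within (fun _ hy => subset_cM_of_mem_cU hy) (isUpSetWithin_cU htw hcore hC)
    (isUpSetWithin_cU0 htw hcore hC) (cU0_subset_cU htw hcore hC) hU₁
    (fibre_partner_subset_cU0 htw hcore hC hx) hne).trans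
    (card_le_card (filter_complWithin_subset_fibre htw hcore hC hx))

/-- The row of a partnerless `r`-free member is not full. -/
theorem fibre_partner_ne_cU0_of_notMem_partner (htw : ∀ a b, Twin F a b → a = b)
    (hcore : ∀ a, ∃ t ∈ F, a ∉ t) (hC : Tight (completion0 r F)) {s : Finset α}
    (hs : s ∈ part0 r F) (hsK : s ∉ partner r F) :
    fibre (cM r F) (partner r F) (s \ cM r F) ≠ cU0 r F := by
  intro h
  have hy : s ∩ cM r F ∈ cU0 r F := inter_cM_mem_cU0_of_mem_part0 htw hcore hC hs
  rw [← h, mem_fibre, sdiff_union_inter] at hy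
  exact hsK hy.2

/-- **The total fibre excess is one**: `Σ_{x ∈ L} (|Z^x| − |K^x|) = 1`. -/
theorem sum_fibre_excess_eq_one (htw : ∀ a b, Twin F a b → a = b)
    (hF : (F \\ F).card = F.card + 1) (hE : (∅ : Finset α) ∉ F) (hU : (univ : Finset α) ∉ F)
    (hcore : ∀ a, ∃ t ∈ F, a ∉ t) (hsupp : ∀ a, ∃ t ∈ F, a ∈ t) (hP : Tight (proj r F))
    (hC : Tight (completion0 r F)) :
    ∑ x ∈ cL r F, ((fibre (cM r F) (diffsY r F) x).card -
      (fibre (cM r F) (partner r F) x).card) = 1 := by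
  rw [sum_tsub_distrib _ (fun x hx => card_fibre_partner_le_card_fibre_diffsY htw hcore hC hx),
    ← card_diffsY_eq_sum_fibre htw hcore hC, ← card_partner_eq_sum_fibre htw hcore hC,
    card_diffsY_of_genuine hF hE hU hcore hsupp hP]
  omega

/-- **The row of a partnerless `r`-free member has fibre excess exactly one.** -/
theorem card_fibre_diffsY_eq_add_one (htw : ∀ a b, Twin F a b → a = b)
    (hF : (F \\ F).card = F.card + 1) (hE : (∅ : Finset α) ∉ F) (hU : (univ : Finset α) ∉ F)
    (hcore : ∀ a, ∃ t ∈ F, a ∉ t) (hsupp : ∀ a, ∃ t ∈ F, a ∈ t) (hP : Tight (proj r F))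
    (hC : Tight (completion0 r F)) (hU₁ : ¬ partr r F ⊆ part0 r F) {s : Finset α}
    (hs : s ∈ part0 r F) (hsK : s ∉ partner r F) :
    (fibre (cM r F) (diffsY r F) (s \ cM r F)).card =
      (fibre (cM r F) (partner r F) (s \ cM r F)).card + 1 := by
  have hx : s \ cM r F ∈ cL r F := sdiff_cM_mem_cL_of_mem_proj htw hcore hC (mem_proj_of_mem_part0 hs)
  have h1 := card_fibre_partner_add_one_le htw hcore hC (cU_sdiff_cU0_nonempty htw hcore hC hU₁) hx
    (fibre_partner_ne_cU0_of_notMem_partner htw hcore hC hs hsK)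
  have h2 : (fibre (cM r F) (diffsY r F) (s \ cM r F)).card -
      (fibre (cM r F) (partner r F) (s \ cM r F)).card ≤ 1 := by
    rw [← sum_fibre_excess_eq_one htw hF hE hU hcore hsupp hP hC]
    exact single_le_sum (f := fun x => (fibre (cM r F) (diffsY r F) x).card -
      (fibre (cM r F) (partner r F) x).card) (fun _ _ => Nat.zero_le _) hx
  omega

/-- **Every other row has fibre excess zero.** -/
theorem card_fibre_diffsY_eq_of_ne (htw : ∀ a b, Twin F a b → a = b)
    (hF : (F \\ F).card = F.card + 1) (hE : (∅ : Finset α) ∉ F) (hU : (univ : Finset α) ∉ F)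
    (hcore : ∀ a, ∃ t ∈ F, a ∉ t) (hsupp : ∀ a, ∃ t ∈ F, a ∈ t) (hP : Tight (proj r F))
    (hC : Tight (completion0 r F)) (hU₁ : ¬ partr r F ⊆ part0 r F) {s : Finset α}
    (hs : s ∈ part0 r F) (hsK : s ∉ partner r F) {x : Finset α} (hx : x ∈ cL r F)
    (hxs : x ≠ s \ cM r F) :
    (fibre (cM r F) (diffsY r F) x).card = (fibre (cM r F) (partner r F) x).card := by
  have hxs' : s \ cM r F ∈ cL r F :=
    sdiff_cM_mem_cL_of_mem_proj htw hcore hC (mem_proj_of_mem_part0 hs)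
  have h1 := card_fibre_partner_add_one_le htw hcore hC (cU_sdiff_cU0_nonempty htw hcore hC hU₁)
    hxs' (fibre_partner_ne_cU0_of_notMem_partner htw hcore hC hs hsK)
  have h0 := card_fibre_partner_le_card_fibre_diffsY htw hcore hC hx
  have hsum := sum_fibre_excess_eq_one htw hF hE hU hcore hsupp hP hC
  have hpair : ∑ z ∈ ({x, s \ cM r F} : Finset (Finset α)),
      ((fibre (cM r F) (diffsY r F) z).card - (fibre (cM r F) (partner r F) z).card) ≤
      ∑ z ∈ cL r F,
        ((fibre (cM r F) (diffsY r F) z).card - (fibre (cM r F) (partner r F) z).card) :=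
    sum_le_sum_of_subset (insert_subset hx (singleton_subset_iff.2 hxs'))
  rw [sum_pair hxs, hsum] at hpair
  omega

/-- **(ROW-a)**: two partnerless `r`-free members lie in the same row, `s ∖ M = s' ∖ M`. -/
theorem sdiff_cM_eq_of_notMem_partner (htw : ∀ a b, Twin F a b → a = b)
    (hF : (F \\ F).card = F.card + 1) (hE : (∅ : Finset α) ∉ F) (hU : (univ : Finset α) ∉ F)
    (hcore : ∀ a, ∃ t ∈ F, a ∉ t) (hsupp : ∀ a, ∃ t ∈ F, a ∈ t) (hP : Tight (proj r F))
    (hC : Tight (completion0 r F)) (hU₁ : ¬ partr r F ⊆ part0 r F) {s s' : Finset α}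
    (hs : s ∈ part0 r F) (hsK : s ∉ partner r F) (hs' : s' ∈ part0 r F)
    (hs'K : s' ∉ partner r F) : s \ cM r F = s' \ cM r F := by
  by_contra hne
  have hx : s \ cM r F ∈ cL r F :=
    sdiff_cM_mem_cL_of_mem_proj htw hcore hC (mem_proj_of_mem_part0 hs)
  have h1 := card_fibre_partner_add_one_le htw hcore hC (cU_sdiff_cU0_nonempty htw hcore hC hU₁) hx
    (fibre_partner_ne_cU0_of_notMem_partner htw hcore hC hs hsK)
  have h0 := card_fibre_diffsY_eq_of_ne htw hF hE hU hcore hsupp hP hC hU₁ hs' hs'K hx hne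
  omega

end RowA

end PercRepro.MSTight
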